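import Summits.QuantumFields.BalabanUV.T4Continuum.Spine.BackgroundResolventTower

/-!
# T⁴ programme, spine node NE2 (U1a), tier B row B4.b — TWO-LEVEL NUMBERS for the factorised `DRD*` summand: sizes and differences of
# the sandwich factors, the unit-layer factor by Neumann, and `‖(Z′J − Z)𝒢‖`, `‖K′ − K‖` from scalar-tower numbers

ROUND-2 swarm `t4-ne2-formalise-*`, leaf prover 05, row **B4.b**, file 2b (file 1 `Support/GaugeTermSandwichLaw`: the abstract law; file 2a
`Support/GaugeTermResolventBounds`: positivity and the `U`- vs `1`-resolvent).  With `Z = Q′(U)·G′(U)·D_U*` (unit layer `υ` ← 1-forms) and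
`N = K⁻¹`, `K = (Q′G′)(Q′G′)ᴴ = Q′G′²Q′*` ([Balaban1985BackgroundPropagators] (3.25) p. 394, the projection `1 − R(U)` factorised), the fields
of `GaugeTermSandwichLaw.SandwichLaws` are NUMBERS produced here from abstract one- and two-level data:
 * §1 sizes/differences of products and Grams (`opNorm_mul_sub_mul_le`, `opNorm_gramK_sub_le`); **`unitFactor_bounds`**: `K_1` invertible,
   `‖K_1⁻¹‖ ≤ n₁` (the `U = 1` datum, row B4.c), `‖K_U − K_1‖ ≤ δK`, `n₁δK < 1` ⟹ `K_U` invertible, `‖K_U⁻¹‖ ≤ n₁(1 − n₁δK)⁻¹`,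
   `‖K_U⁻¹ − K_1⁻¹‖ ≤ n₁·δK·n₁·(1 − n₁δK)⁻¹` (Neumann, `BackgroundResolventLaw`); `opNorm_inv_sub_inv_le_of_isUnit` for `N′ − N`.
 * §2 TWO-LEVEL NUMBERS (abstract plantings `J` (1-forms), `J₀` (0-forms), free 1-form propagator `𝒢` on the right):
   **`opNorm_Z_twoLevel_le`** `‖(Z′J − Z)𝒢‖ ≤ q′θ + q′e_s‖Dᴴ𝒢‖ + ‖Q′J₀ − Q‖‖GDᴴ‖‖𝒢‖` from the exact splitting `outer_twoLevel_split`, the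
   sandwiched covariant-divergence planting number `θ = ‖G′(D′ᴴJ − J₀Dᴴ)𝒢‖` (row B4.f) and the scalar injected number `e_s = ‖G′J₀ − J₀G‖`;
   **`opNorm_gramK_twoLevel_le`** `‖K′ − K‖ ≤ 2‖Y‖ε + ε² + q′e_c‖Y′‖` from the exact `Y′Y′ᴴ = (Y′J₀)(Y′J₀)ᴴ + Y′(1 − J₀J₀ᴴ)Y′ᴴ`
   (`gramK_twoLevel_eq`), `outer_E_le`, and the scalar complement number `e_c = ‖G′(1 − J₀J₀ᴴ)‖`.  `e_s`, `e_c` are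
   `BackgroundResolventLaw.perturbed_injected_law` / a Neumann factor times the free complement defect ON THE SCALAR TOWER (its
   `FreeTowerLaws` = row B4.d, its `PerturbationLaws` = row B4.e); the transport data `‖Q′J₀ − Q‖`, `‖Q_U − Q_1‖` are rows B3.a/B3.b-conc.

HONEST FRAMING (T4-DAG p. 1).  [folklore]-level finite-dimensional linear algebra in the `ℓ²`-operator norm, statements OURS; model level
when instantiated (no assertion of the dictionary B0, trigger c5); GLOBAL small field, finite torus, linear layer; NOT [B9] (3.23)–(3.26)
as printed; NE2 NOT proved; NOT infinite volume, NOT a mass gap, NOT Clay, NOT summit progress; spine 0/9 unchanged.  HONEST DEPENDENCY: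
continuum YM on T⁴ ⇐ BetaPertH ∧ nine spine estimates (0/9 proved); BetaPertH ⇐ (D1) ∧ (D4) ∧ CAP+tail; G-an2-4 gates asym, D1 and
NE2/3/4.  ABSOLUTE RULE kept: nothing printed is a hypothesis; no `sorry`.
-/

noncomputable section

open scoped BigOperators ComplexConjugate Matrix Matrix.Norms.L2Operator

namespace Summit.QuantumFields.BalabanUV.T4Continuum.GaugeTermTwoLevelNumbers

open Summit.QuantumFields.BalabanUV.T4Continuum
open Summit.QuantumFields.BalabanUV.T4Continuum.BackgroundResolventLaw

/-! ## §1 Sizes and differences of the sandwich factors; the unit-layer factor by Neumann -/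

section Factors

variable {σ τ υ : Type*} [Fintype σ] [DecidableEq σ] [Fintype τ] [DecidableEq τ] [Fintype υ] [DecidableEq υ]

omit [DecidableEq υ] in
/-- products move by their factors: `‖AB − A′B′‖ ≤ ‖A − A′‖·‖B‖ + ‖A′‖·‖B − B′‖`. [folklore] -/
theorem opNorm_mul_sub_mul_le (A A' : Matrix υ σ ℂ) (B B' : Matrix σ τ ℂ) :
    ‖A * B - A' * B'‖ ≤ ‖A - A'‖ * ‖B‖ + ‖A'‖ * ‖B - B'‖ := by
  have e : A * B - A' * B' = (A - A') * B + A' * (B - B') := by rw [Matrix.sub_mul, Matrix.mul_sub]; abel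
  rw [e]
  exact (norm_add_le _ _).trans (add_le_add (Matrix.l2_opNorm_mul _ _) (Matrix.l2_opNorm_mul _ _))

/-- Gram products move by their factor: `‖AAᴴ − BBᴴ‖ ≤ ‖A − B‖·(‖A‖ + ‖B‖)`. [folklore] -/
theorem opNorm_gramK_sub_le (A B : Matrix υ σ ℂ) : ‖A * Aᴴ - B * Bᴴ‖ ≤ ‖A - B‖ * (‖A‖ + ‖B‖) := by
  have e : A * Aᴴ - B * Bᴴ = (A - B) * Aᴴ + B * (A - B)ᴴ := by
    rw [Matrix.sub_mul, Matrix.conjTranspose_sub, Matrix.mul_sub]; abel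
  rw [e]
  calc _ ≤ ‖(A - B) * Aᴴ‖ + ‖B * (A - B)ᴴ‖ := norm_add_le _ _
    _ ≤ ‖A - B‖ * ‖Aᴴ‖ + ‖B‖ * ‖(A - B)ᴴ‖ := add_le_add (Matrix.l2_opNorm_mul _ _) (Matrix.l2_opNorm_mul _ _)
    _ = ‖A - B‖ * (‖A‖ + ‖B‖) := by rw [Matrix.l2_opNorm_conjTranspose, Matrix.l2_opNorm_conjTranspose]; ring

/-- **THE UNIT-LAYER FACTOR BY NEUMANN**: `K_1` invertible with `‖K_1⁻¹‖ ≤ n₁`, `‖K_U − K_1‖ ≤ δK`, `n₁·δK < 1` ⟹ `K_U`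
invertible, `‖K_U⁻¹‖ ≤ n₁(1 − n₁δK)⁻¹` and `‖K_U⁻¹ − K_1⁻¹‖ ≤ n₁·δK·n₁·(1 − n₁δK)⁻¹` (for row B4: `K = Q′G′²Q′*` on the unit
lattice, `N = K⁻¹`, the `U = 1` datum `n₁` is row B4.c's). [folklore] -/
theorem unitFactor_bounds {K₁ Ku : Matrix υ υ ℂ} (hK₁ : IsUnit K₁.det) {n₁ δK : ℝ} (hn₁ : ‖K₁⁻¹‖ ≤ n₁) (hdK : ‖Ku - K₁‖ ≤ δK)
    (hsmall : n₁ * δK < 1) :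
    IsUnit Ku.det ∧ ‖Ku⁻¹‖ ≤ n₁ * (1 - n₁ * δK)⁻¹ ∧ ‖Ku⁻¹ - K₁⁻¹‖ ≤ n₁ * δK * n₁ * (1 - n₁ * δK)⁻¹ := by
  have hn0 : 0 ≤ n₁ := (norm_nonneg _).trans hn₁
  have hd0 : 0 ≤ δK := (norm_nonneg _).trans hdK
  have hP : ‖(Ku - K₁) * K₁⁻¹‖ ≤ n₁ * δK := by
    rw [mul_comm n₁]; exact (Matrix.l2_opNorm_mul _ _).trans (mul_le_mul hdK hn₁ (norm_nonneg _) hd0)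
  have hP' : ‖K₁⁻¹ * (Ku - K₁)‖ ≤ n₁ * δK := (Matrix.l2_opNorm_mul _ _).trans (mul_le_mul hn₁ hdK (norm_nonneg _) hn0)
  have ht : ‖(1 : ℂ)‖ * (n₁ * δK) < 1 := by rw [norm_one, one_mul]; exact hsmall
  have e : K₁ + (1 : ℂ) • (Ku - K₁) = Ku := by rw [one_smul, add_sub_cancel]
  have hν : 0 ≤ (1 - n₁ * δK)⁻¹ := inv_nonneg.mpr (sub_nonneg.mpr hsmall.le)
  refine ⟨?_, ?_, ?_⟩
  · have h := isUnit_det_add_smul_right hK₁ hP ht; rwa [e] at h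
  · have h := opNorm_inv_add_smul_le hK₁ hP ht
    rw [e, norm_one, one_mul] at h
    exact h.trans (mul_le_mul_of_nonneg_right hn₁ hν)
  · have h := opNorm_inv_add_smul_sub_inv_le hK₁ hP hP' ht
    rw [e, norm_one, one_mul] at h
    exact h.trans (mul_le_mul_of_nonneg_right (mul_le_mul_of_nonneg_left hn₁ (mul_nonneg hn0 hd0)) hν)

/-- the resolvent identity `A⁻¹ − B⁻¹ = A⁻¹(B − A)B⁻¹`. [folklore] -/
theorem inv_sub_inv_eq' {A B : Matrix υ υ ℂ} (hA : IsUnit A.det) (hB : IsUnit B.det) : A⁻¹ - B⁻¹ = A⁻¹ * (B - A) * B⁻¹ := by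
  rw [Matrix.mul_sub, Matrix.sub_mul, Matrix.mul_assoc, Matrix.mul_nonsing_inv B hB, Matrix.mul_one, Matrix.nonsing_inv_mul A hA,
    Matrix.one_mul]

/-- `‖A⁻¹ − B⁻¹‖ ≤ ‖A⁻¹‖·‖A − B‖·‖B⁻¹‖` (both invertible) — the two-level move of the unit-layer factor `N = K⁻¹` from that of `K`.
[folklore] -/
theorem opNorm_inv_sub_inv_le_of_isUnit {A B : Matrix υ υ ℂ} (hA : IsUnit A.det) (hB : IsUnit B.det) :
    ‖A⁻¹ - B⁻¹‖ ≤ ‖A⁻¹‖ * ‖A - B‖ * ‖B⁻¹‖ := by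
  rw [inv_sub_inv_eq' hA hB]
  calc _ ≤ ‖A⁻¹ * (B - A)‖ * ‖B⁻¹‖ := Matrix.l2_opNorm_mul _ _
    _ ≤ ‖A⁻¹‖ * ‖B - A‖ * ‖B⁻¹‖ := mul_le_mul_of_nonneg_right (Matrix.l2_opNorm_mul _ _) (norm_nonneg _)
    _ = _ := by rw [norm_sub_rev]

end Factors

/-! ## §2 Two-level numbers: `‖(Z′J − Z)𝒢‖` and `‖K′ − K‖` from scalar-tower numbers -/

section TwoLevel

variable {σ τ σ' τ' υ : Type*} [Fintype σ] [DecidableEq σ] [Fintype τ] [DecidableEq τ] [Fintype σ'] [DecidableEq σ']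
  [Fintype τ'] [DecidableEq τ'] [Fintype υ] [DecidableEq υ]

omit [DecidableEq σ] [Fintype τ] [DecidableEq τ] [DecidableEq σ'] [DecidableEq τ'] [Fintype υ] [DecidableEq υ] in
/-- the exact two-level splitting of the outer factor `Z = Q·G·Dᴴ`:
`Q′G′D′ᴴJ − QGDᴴ = Q′G′(D′ᴴJ − J₀Dᴴ) + Q′(G′J₀ − J₀G)Dᴴ + (Q′J₀ − Q)GDᴴ`. [folklore] -/
theorem outer_twoLevel_split (Q : Matrix υ σ ℂ) (Q' : Matrix υ σ' ℂ) (G : Matrix σ σ ℂ) (G' : Matrix σ' σ' ℂ) (D : Matrix τ σ ℂ)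
    (D' : Matrix τ' σ' ℂ) (J : Matrix τ' τ ℂ) (J₀ : Matrix σ' σ ℂ) :
    Q' * G' * D'ᴴ * J - Q * G * Dᴴ
      = Q' * G' * (D'ᴴ * J - J₀ * Dᴴ) + Q' * (G' * J₀ - J₀ * G) * Dᴴ + (Q' * J₀ - Q) * G * Dᴴ := by
  simp only [Matrix.mul_sub, Matrix.sub_mul, Matrix.mul_assoc]
  abel

omit [DecidableEq τ'] [DecidableEq υ] in
/-- **THE OUTER FACTOR'S SANDWICHED TWO-LEVEL NUMBER**: `‖(Z′J − Z)𝒢‖ ≤ q′·θ + q′·e_s·‖Dᴴ𝒢‖ + ‖Q′J₀ − Q‖·‖GDᴴ‖·‖𝒢‖`, where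
`θ = ‖G′(D′ᴴJ − J₀Dᴴ)𝒢‖` is the sandwiched covariant-divergence planting number (row B4.f) and `e_s = ‖G′J₀ − J₀G‖` the scalar
injected number (`BackgroundResolventLaw.perturbed_injected_law` on the scalar tower, rows B4.d + B4.e). [folklore] -/
theorem opNorm_Z_twoLevel_le {Q : Matrix υ σ ℂ} {Q' : Matrix υ σ' ℂ} {G : Matrix σ σ ℂ} {G' : Matrix σ' σ' ℂ} {D : Matrix τ σ ℂ}
    {D' : Matrix τ' σ' ℂ} {J : Matrix τ' τ ℂ} {J₀ : Matrix σ' σ ℂ} {𝒢 : Matrix τ τ ℂ} {q' θ es dG gD g q₁ : ℝ}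
    (hQ' : ‖Q'‖ ≤ q') (hθ : ‖G' * (D'ᴴ * J - J₀ * Dᴴ) * 𝒢‖ ≤ θ) (hes : ‖G' * J₀ - J₀ * G‖ ≤ es) (hdG : ‖Dᴴ * 𝒢‖ ≤ dG)
    (hgD : ‖G * Dᴴ‖ ≤ gD) (hg : ‖𝒢‖ ≤ g) (hq₁ : ‖Q' * J₀ - Q‖ ≤ q₁) :
    ‖(Q' * G' * D'ᴴ * J - Q * G * Dᴴ) * 𝒢‖ ≤ q' * θ + q' * es * dG + q₁ * gD * g := by
  have hq' : 0 ≤ q' := (norm_nonneg _).trans hQ'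
  have hes0 : 0 ≤ es := (norm_nonneg _).trans hes
  have hq₁0 : 0 ≤ q₁ := (norm_nonneg _).trans hq₁
  have hgD0 : 0 ≤ gD := (norm_nonneg _).trans hgD
  rw [outer_twoLevel_split, Matrix.add_mul, Matrix.add_mul]
  have t1 : ‖Q' * G' * (D'ᴴ * J - J₀ * Dᴴ) * 𝒢‖ ≤ q' * θ := by
    have e : Q' * G' * (D'ᴴ * J - J₀ * Dᴴ) * 𝒢 = Q' * (G' * (D'ᴴ * J - J₀ * Dᴴ) * 𝒢) := by simp only [Matrix.mul_assoc]
    rw [e]; exact (Matrix.l2_opNorm_mul _ _).trans (mul_le_mul hQ' hθ (norm_nonneg _) hq')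
  have t2 : ‖Q' * (G' * J₀ - J₀ * G) * Dᴴ * 𝒢‖ ≤ q' * es * dG := by
    rw [Matrix.mul_assoc]
    exact (Matrix.l2_opNorm_mul _ _).trans (mul_le_mul ((Matrix.l2_opNorm_mul _ _).trans (mul_le_mul hQ' hes (norm_nonneg _) hq'))
      hdG (norm_nonneg _) (mul_nonneg hq' hes0))
  have t3 : ‖(Q' * J₀ - Q) * G * Dᴴ * 𝒢‖ ≤ q₁ * gD * g := by
    rw [Matrix.mul_assoc (Q' * J₀ - Q)]
    exact (Matrix.l2_opNorm_mul _ _).trans (mul_le_mul ((Matrix.l2_opNorm_mul _ _).trans (mul_le_mul hq₁ hgD (norm_nonneg _) hq₁0))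
      hg (norm_nonneg _) (mul_nonneg hq₁0 hgD0))
  calc _ ≤ ‖Q' * G' * (D'ᴴ * J - J₀ * Dᴴ) * 𝒢 + Q' * (G' * J₀ - J₀ * G) * Dᴴ * 𝒢‖ + ‖(Q' * J₀ - Q) * G * Dᴴ * 𝒢‖ := norm_add_le _ _
    _ ≤ (‖Q' * G' * (D'ᴴ * J - J₀ * Dᴴ) * 𝒢‖ + ‖Q' * (G' * J₀ - J₀ * G) * Dᴴ * 𝒢‖) + ‖(Q' * J₀ - Q) * G * Dᴴ * 𝒢‖ :=
        add_le_add (norm_add_le _ _) le_rfl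
    _ ≤ _ := add_le_add (add_le_add t1 t2) t3

omit [DecidableEq σ] [Fintype υ] [DecidableEq υ] in
/-- the exact identity `Y′Y′ᴴ = (Y′J₀)(Y′J₀)ᴴ + Y′(1 − J₀J₀ᴴ)Y′ᴴ`. [folklore] -/
theorem gramK_twoLevel_eq (Y' : Matrix υ σ' ℂ) (J₀ : Matrix σ' σ ℂ) :
    Y' * Y'ᴴ = (Y' * J₀) * (Y' * J₀)ᴴ + Y' * (1 - J₀ * J₀ᴴ) * Y'ᴴ := by
  rw [Matrix.conjTranspose_mul, Matrix.mul_sub, Matrix.mul_one, Matrix.sub_mul]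
  simp only [Matrix.mul_assoc]
  abel

/-- **THE UNIT-LAYER GRAM'S TWO-LEVEL NUMBER**: with `Y = Q·G`, `Y′ = Q′·G′`, `E := Y′J₀ − Y`:
`‖Y′Y′ᴴ − YYᴴ‖ ≤ 2‖Y‖·ε + ε² + q′·e_c·‖Y′‖` whenever `‖E‖ ≤ ε` and `‖G′(1 − J₀J₀ᴴ)‖ ≤ e_c` (the scalar complement number);
and `‖E‖ ≤ ‖Q′J₀ − Q‖·‖G‖ + ‖Q′‖·‖G′J₀ − J₀G‖` (`outer_E_le`). [folklore] -/
theorem opNorm_gramK_twoLevel_le {Q : Matrix υ σ ℂ} {Q' : Matrix υ σ' ℂ} {G : Matrix σ σ ℂ} {G' : Matrix σ' σ' ℂ}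
    {J₀ : Matrix σ' σ ℂ} {q' ε ec yb yb' : ℝ} (hQ' : ‖Q'‖ ≤ q') (hE : ‖Q' * G' * J₀ - Q * G‖ ≤ ε)
    (hec : ‖G' * (1 - J₀ * J₀ᴴ)‖ ≤ ec) (hY : ‖Q * G‖ ≤ yb) (hY' : ‖Q' * G'‖ ≤ yb') :
    ‖Q' * G' * (Q' * G')ᴴ - Q * G * (Q * G)ᴴ‖ ≤ 2 * yb * ε + ε * ε + q' * ec * yb' := by
  have hq' : 0 ≤ q' := (norm_nonneg _).trans hQ'
  have hε : 0 ≤ ε := (norm_nonneg _).trans hE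
  have hec0 : 0 ≤ ec := (norm_nonneg _).trans hec
  set Y := Q * G
  set Y' := Q' * G'
  set E := Y' * J₀ - Y with hEdef
  have hYJ : Y' * J₀ = Y + E := by rw [hEdef]; abel
  rw [gramK_twoLevel_eq Y' J₀, hYJ]
  have e : (Y + E) * (Y + E)ᴴ + Y' * (1 - J₀ * J₀ᴴ) * Y'ᴴ - Y * Yᴴ = E * Yᴴ + Y * Eᴴ + E * Eᴴ + Y' * (1 - J₀ * J₀ᴴ) * Y'ᴴ := by
    rw [Matrix.conjTranspose_add, Matrix.add_mul, Matrix.mul_add, Matrix.mul_add]; abel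
  rw [e]
  have hEH : ‖Eᴴ‖ ≤ ε := by rw [Matrix.l2_opNorm_conjTranspose]; exact hE
  have hYH : ‖Yᴴ‖ ≤ yb := by rw [Matrix.l2_opNorm_conjTranspose]; exact hY
  have hY'H : ‖Y'ᴴ‖ ≤ yb' := by rw [Matrix.l2_opNorm_conjTranspose]; exact hY'
  have hyb : 0 ≤ yb := (norm_nonneg _).trans hY
  have t1 : ‖E * Yᴴ‖ ≤ ε * yb := (Matrix.l2_opNorm_mul _ _).trans (mul_le_mul hE hYH (norm_nonneg _) hε)
  have t2 : ‖Y * Eᴴ‖ ≤ yb * ε := (Matrix.l2_opNorm_mul _ _).trans (mul_le_mul hY hEH (norm_nonneg _) hyb)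
  have t3 : ‖E * Eᴴ‖ ≤ ε * ε := (Matrix.l2_opNorm_mul _ _).trans (mul_le_mul hE hEH (norm_nonneg _) hε)
  have t4 : ‖Y' * (1 - J₀ * J₀ᴴ) * Y'ᴴ‖ ≤ q' * ec * yb' := by
    have e4 : Y' * (1 - J₀ * J₀ᴴ) * Y'ᴴ = Q' * (G' * (1 - J₀ * J₀ᴴ)) * Y'ᴴ := by simp only [Y', Matrix.mul_assoc]
    rw [e4]
    exact (Matrix.l2_opNorm_mul _ _).trans (mul_le_mul ((Matrix.l2_opNorm_mul _ _).trans (mul_le_mul hQ' hec (norm_nonneg _) hq'))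
      hY'H (norm_nonneg _) (mul_nonneg hq' hec0))
  calc _ ≤ ‖E * Yᴴ + Y * Eᴴ + E * Eᴴ‖ + ‖Y' * (1 - J₀ * J₀ᴴ) * Y'ᴴ‖ := norm_add_le _ _
    _ ≤ ((‖E * Yᴴ‖ + ‖Y * Eᴴ‖) + ‖E * Eᴴ‖) + ‖Y' * (1 - J₀ * J₀ᴴ) * Y'ᴴ‖ :=
        add_le_add ((norm_add_le _ _).trans (add_le_add (norm_add_le _ _) le_rfl)) le_rfl
    _ ≤ ((ε * yb + yb * ε) + ε * ε) + q' * ec * yb' := add_le_add (add_le_add (add_le_add t1 t2) t3) t4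
    _ = _ := by ring

omit [DecidableEq υ] in
/-- the outer two-level error `E = Q′G′J₀ − QG = Q′(G′J₀ − J₀G) + (Q′J₀ − Q)G`: `‖E‖ ≤ q′·e_s + ‖Q′J₀ − Q‖·‖G‖`. [folklore] -/
theorem outer_E_le {Q : Matrix υ σ ℂ} {Q' : Matrix υ σ' ℂ} {G : Matrix σ σ ℂ} {G' : Matrix σ' σ' ℂ} {J₀ : Matrix σ' σ ℂ}
    {q' es q₁ g : ℝ} (hQ' : ‖Q'‖ ≤ q') (hes : ‖G' * J₀ - J₀ * G‖ ≤ es) (hq₁ : ‖Q' * J₀ - Q‖ ≤ q₁) (hg : ‖G‖ ≤ g) :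
    ‖Q' * G' * J₀ - Q * G‖ ≤ q' * es + q₁ * g := by
  have e : Q' * G' * J₀ - Q * G = Q' * (G' * J₀ - J₀ * G) + (Q' * J₀ - Q) * G := by
    rw [Matrix.mul_sub, Matrix.sub_mul, Matrix.mul_assoc, ← Matrix.mul_assoc Q' J₀ G]; abel
  rw [e]
  exact (norm_add_le _ _).trans (add_le_add ((Matrix.l2_opNorm_mul _ _).trans (mul_le_mul hQ' hes (norm_nonneg _)
    ((norm_nonneg _).trans hQ'))) ((Matrix.l2_opNorm_mul _ _).trans (mul_le_mul hq₁ hg (norm_nonneg _) ((norm_nonneg _).trans hq₁))))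

end TwoLevel

end Summit.QuantumFields.BalabanUV.T4Continuum.GaugeTermTwoLevelNumbers

end
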